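import Mathlib.RingTheory.Polynomial.GaussLemma
import Mathlib.RingTheory.Polynomial.Content
import Mathlib.RingTheory.Localization.Integral
import Mathlib.RingTheory.Localization.FractionRing
import Mathlib.RingTheory.PrincipalIdealDomain
import Mathlib.Algebra.Polynomial.Reverse
import Mathlib.Algebra.Polynomial.Div
import Mathlib.Algebra.Polynomial.Roots
import Mathlib.Algebra.MvPolynomial.Equiv
import Mathlib.Analysis.Complex.Basic
import Mathlib.FieldTheory.IsAlgClosed.Basic
import HarnessLib

/-!
# The fixed singular points of `Q(z,w) w' = P(z,w)` (algebraic part of Painlevé's theorem)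

Infrastructure for the proof of `painleve_firstOrder_firstDegree`
(`Literature/Analysis/ODE/PainleveFirstOrder.lean`), following E. Hille, *Lectures on Ordinary
Differential Equations* (1969), proof of Thm. 12.1.1: for coprime polynomials `P, Q ∈ ℂ[z, w]`,
`Q ≠ 0`, the set `S` of FIXED SINGULAR POINTS of the equation is finite. Hille's list
(12.1.11)–(12.1.14): the points `rᵢ` where `Q(rᵢ, ·) ≡ 0` ("Case 3"), the points `eᵢ` over
which `P = Q = 0` have a common root (elimination of `w`), and the points `iᵢ` obtained in the
same way from the equation transformed by `w = 1/v`,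
`v' = -v² P(z, 1/v)/Q(z, 1/v) = P₁(z, v)/Q₁(z, v)`.

We work in `ℂ[z][w] = Polynomial (Polynomial ℂ)` (transported from `MvPolynomial (Fin 2) ℂ` by
`exists_bivariate_algEquiv`) and prove:

* `exists_bezout_of_isRelPrime` — coprime `P, Q ∈ ℂ[z][w]` satisfy `A P + B Q = c(z)` with
  `0 ≠ c ∈ ℂ[z]` (Gauss's lemma + Bézout in `ℂ(z)[w]`), so the `z`-projection of `{P = Q = 0}`
  lies in the finite root set of `c` (`isRoot_of_common_zero`);
* `isRoot_leadingCoeff_of_forall_eval₂_eq_zero` — `Q(z₁, ·) ≡ 0` forces `z₁` to be a root of the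
  leading coefficient of `Q`;
* `exists_infinity_data` — the transformed pair `(P₁, Q₁)` with the common power of `v`
  cancelled, the pointwise identity `Q₁(z, 1/w) · (-w'/w²) = P₁(z, 1/w)` whenever
  `Q(z, w) w' = P(z, w)`, `w ≠ 0`, and a nonzero `c ∈ ℂ[z]` off whose roots
  `(P₁(z, 0), Q₁(z, 0)) ≠ (0, 0)`;
* `fixedSingular_package` — everything assembled back in `MvPolynomial (Fin 2) ℂ`: a finite
  `S ⊆ ℂ` and polynomials `N₁, D₁` with the four properties used by the analytic part of the
  proof.

## References

* E. Hille, *Lectures on Ordinary Differential Equations*, Addison-Wesley 1969, §12.1, proof of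
  Thm. 12.1.1, (12.1.11)–(12.1.14). [cite: Hille1969, §12.1 (12.1.11)–(12.1.14)]
-/

noncomputable section

namespace Literature.Analysis.ODE

open Polynomial

/-! ### `ℂ[z, w] ≅ ℂ[z][w]` -/

/-- The algebra isomorphism `MvPolynomial (Fin 2) ℂ ≃ ℂ[z][w]` sending `X 0 ↦ z` (the constant
polynomial `C X` in `w`) and `X 1 ↦ w` (the variable `X`), together with the evaluation rule
`(e R)(z)(w) = R(z, w)`. [folklore] -/
theorem exists_bivariate_algEquiv :
    ∃ e : MvPolynomial (Fin 2) ℂ ≃ₐ[ℂ] Polynomial (Polynomial ℂ),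
      ∀ (R : MvPolynomial (Fin 2) ℂ) (z w : ℂ),
        (e R).eval₂ (Polynomial.evalRingHom z) w = MvPolynomial.eval ![z, w] R := by
  let φ : MvPolynomial (Fin 2) ℂ →ₐ[ℂ] Polynomial (Polynomial ℂ) :=
    MvPolynomial.aeval ![Polynomial.C Polynomial.X, Polynomial.X]
  let ψ₀ : Polynomial ℂ →ₐ[ℂ] MvPolynomial (Fin 2) ℂ := Polynomial.aeval (MvPolynomial.X 0)
  let ψ : Polynomial (Polynomial ℂ) →ₐ[ℂ] MvPolynomial (Fin 2) ℂ :=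
    Polynomial.eval₂AlgHom ψ₀ (MvPolynomial.X 1) (fun a => Commute.all _ _)
  have h₁ : φ.comp ψ = AlgHom.id ℂ _ := by
    apply Polynomial.algHom_ext'
    · apply Polynomial.algHom_ext
      simp [φ, ψ, ψ₀]
    · simp [φ, ψ]
  have h₂ : ψ.comp φ = AlgHom.id ℂ _ := by
    apply MvPolynomial.algHom_ext
    intro i
    fin_cases i <;> simp [φ, ψ, ψ₀]
  refine ⟨AlgEquiv.ofAlgHom φ ψ h₁ h₂, fun R z w => ?_⟩
  change (Polynomial.eval₂RingHom (Polynomial.evalRingHom z) w).comp φ.toRingHom R =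
    MvPolynomial.eval ![z, w] R
  congr 1
  apply MvPolynomial.ringHom_ext
  · intro r
    simp [φ]
  · intro i
    fin_cases i <;> simp [φ]

/-! ### Bézout with a nonzero `z`-polynomial (Gauss's lemma) -/

section Bezout

variable {K : Type*} [Field K] [Algebra (Polynomial ℂ) K] [IsFractionRing (Polynomial ℂ) K]
variable {P Q : Polynomial (Polynomial ℂ)}

variable (K) in
/-- If `d ∈ ℂ(z)[w]` divides the images of `P` and `Q` and `P, Q` are coprime in `ℂ[z][w]`, then
`d` is a unit (Gauss's lemma: the primitive part of a denominator-cleared `d` divides `P` and `Q`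
in `ℂ[z][w]`). [folklore] -/
theorem isRelPrime_map_fractionRing (h : IsRelPrime P Q) :
    IsRelPrime (P.map (algebraMap (Polynomial ℂ) K)) (Q.map (algebraMap (Polynomial ℂ) K)) := by
  have hinj : Function.Injective (algebraMap (Polynomial ℂ) K) := IsFractionRing.injective _ _
  intro d hdP hdQ
  by_cases hd : d = 0
  · subst hd
    have hP : P = 0 := by
      rw [zero_dvd_iff, Polynomial.map_eq_zero_iff hinj] at hdP
      exact hdP
    have hQ : Q = 0 := by
      rw [zero_dvd_iff, Polynomial.map_eq_zero_iff hinj] at hdQ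
      exact hdQ
    subst hP hQ
    exact absurd (isRelPrime_zero_left.mp h) not_isUnit_zero
  -- clear denominators
  obtain ⟨b, hb, hbd⟩ :=
    IsLocalization.integerNormalization_spec (nonZeroDivisors (Polynomial ℂ)) d
  set d₀ := IsLocalization.integerNormalization (nonZeroDivisors (Polynomial ℂ)) d with hd₀
  have hb0 : algebraMap (Polynomial ℂ) K b ≠ 0 :=
    IsFractionRing.to_map_ne_zero_of_mem_nonZeroDivisors hb
  have hd_eq : d = Polynomial.C (algebraMap (Polynomial ℂ) K b)⁻¹ * d₀.map (algebraMap _ K) := by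
    rw [hbd, Algebra.smul_def, Polynomial.algebraMap_apply, ← mul_assoc, ← Polynomial.C_mul,
      inv_mul_cancel₀ hb0, Polynomial.C_1, one_mul]
  have hd₀0 : d₀ ≠ 0 := by
    intro h0
    apply hd
    rw [hd_eq, h0, Polynomial.map_zero, mul_zero]
  -- the primitive part of `d₀`
  set d₁ := d₀.primPart with hd₁
  have hd₁prim : d₁.IsPrimitive := Polynomial.isPrimitive_primPart d₀
  have hcont : d₀.content ≠ 0 := by rwa [Ne, Polynomial.content_eq_zero_iff]
  have hγ : algebraMap (Polynomial ℂ) K d₀.content ≠ 0 := fun h0 => hcont (hinj (by simpa using h0))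
  have hd_eq' : d = Polynomial.C ((algebraMap (Polynomial ℂ) K b)⁻¹ *
      algebraMap (Polynomial ℂ) K d₀.content) * d₁.map (algebraMap _ K) := by
    conv_lhs => rw [hd_eq, Polynomial.eq_C_content_mul_primPart d₀]
    rw [Polynomial.map_mul, Polynomial.map_C, Polynomial.C_mul]
    ring
  have hunit : IsUnit (Polynomial.C ((algebraMap (Polynomial ℂ) K b)⁻¹ *
      algebraMap (Polynomial ℂ) K d₀.content)) :=
    Polynomial.isUnit_C.mpr (IsUnit.mk0 _ (mul_ne_zero (inv_ne_zero hb0) hγ))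
  have hdvd : ∀ R : Polynomial (Polynomial ℂ), d ∣ R.map (algebraMap _ K) → d₁ ∣ R := by
    intro R hR
    apply hd₁prim.dvd_of_fraction_map_dvd_fraction_map (K := K)
    rw [hd_eq'] at hR
    exact (hunit.mul_left_dvd).mp hR
  have h₁ : IsUnit d₁ := h (hdvd P hdP) (hdvd Q hdQ)
  rw [hd_eq']
  exact hunit.mul (h₁.map (Polynomial.mapRingHom (algebraMap (Polynomial ℂ) K)))

/-- **Bézout with elimination of `w`**: for coprime `P, Q ∈ ℂ[z][w]` there are `A, B ∈ ℂ[z][w]`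
and `0 ≠ c ∈ ℂ[z]` with `A P + B Q = c`. (Hille: "elimination of `w` between `P = 0`, `Q = 0`
leads to a determinant … equated to 0", (12.1.13); here via Bézout in `ℂ(z)[w]` and clearing
denominators.) [cite: Hille1969, §12.1 (12.1.13)] -/
theorem exists_bezout_of_isRelPrime (h : IsRelPrime P Q) :
    ∃ (c : Polynomial ℂ) (A B : Polynomial (Polynomial ℂ)), c ≠ 0 ∧
      A * P + B * Q = Polynomial.C c := by
  let K := FractionRing (Polynomial ℂ)
  have hinj : Function.Injective (algebraMap (Polynomial ℂ) K) := IsFractionRing.injective _ _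
  have hcop : IsCoprime (P.map (algebraMap (Polynomial ℂ) K))
      (Q.map (algebraMap (Polynomial ℂ) K)) :=
    (isRelPrime_map_fractionRing K h).isCoprime
  obtain ⟨a, b, hab⟩ := hcop
  obtain ⟨ca, hca, ha⟩ :=
    IsLocalization.integerNormalization_spec (nonZeroDivisors (Polynomial ℂ)) a
  obtain ⟨cb, hcb, hb⟩ :=
    IsLocalization.integerNormalization_spec (nonZeroDivisors (Polynomial ℂ)) b
  set a₀ := IsLocalization.integerNormalization (nonZeroDivisors (Polynomial ℂ)) a
  set b₀ := IsLocalization.integerNormalization (nonZeroDivisors (Polynomial ℂ)) b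
  refine ⟨ca * cb, a₀ * Polynomial.C cb, b₀ * Polynomial.C ca, ?_, ?_⟩
  · exact nonZeroDivisors.ne_zero (Submonoid.mul_mem _ hca hcb)
  · apply Polynomial.map_injective (algebraMap (Polynomial ℂ) K) hinj
    simp only [Polynomial.map_add, Polynomial.map_mul, Polynomial.map_C, ha, hb, map_mul,
      Algebra.smul_def, Polynomial.algebraMap_apply]
    linear_combination
      (Polynomial.C (algebraMap (Polynomial ℂ) K ca) * Polynomial.C (algebraMap (Polynomial ℂ) K cb)) * hab

/-- Over a point `z₁` where `P(z₁, ·)` and `Q(z₁, ·)` have a common zero `w₁`, the Bézout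
element `c` vanishes: the `z`-projection of `{P = Q = 0}` is contained in the (finite) root set
of `c`. [cite: Hille1969, §12.1 (12.1.13)] -/
theorem isRoot_of_common_zero {c : Polynomial ℂ} {A B : Polynomial (Polynomial ℂ)}
    (hc : A * P + B * Q = Polynomial.C c) {z₁ w₁ : ℂ}
    (hP : P.eval₂ (Polynomial.evalRingHom z₁) w₁ = 0)
    (hQ : Q.eval₂ (Polynomial.evalRingHom z₁) w₁ = 0) : c.IsRoot z₁ := by
  have h := congr_arg (Polynomial.eval₂ (Polynomial.evalRingHom z₁) w₁) hc
  rw [Polynomial.eval₂_add, Polynomial.eval₂_mul, Polynomial.eval₂_mul, hP, hQ,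
    Polynomial.eval₂_C] at h
  simpa using h.symm

end Bezout

/-! ### Points where `Q(z₁, ·) ≡ 0` -/

/-- If `Q(z₁, w) = 0` for every `w`, then `z₁` is a root of the leading coefficient of `Q`
(indeed of every coefficient `Q_k(z)`, Hille (12.1.12)). [cite: Hille1969, §12.1 (12.1.12)] -/
theorem isRoot_leadingCoeff_of_forall_eval₂_eq_zero {Q : Polynomial (Polynomial ℂ)} {z₁ : ℂ}
    (h : ∀ w : ℂ, Q.eval₂ (Polynomial.evalRingHom z₁) w = 0) : Q.leadingCoeff.IsRoot z₁ := by
  have h0 : Q.map (Polynomial.evalRingHom z₁) = 0 := by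
    apply Polynomial.funext
    intro w
    rw [Polynomial.eval_map, Polynomial.eval_zero]
    exact h w
  have h1 := congr_arg (fun p => p.coeff Q.natDegree) h0
  simp only [Polynomial.coeff_map, Polynomial.coeff_zero] at h1
  exact h1

/-- Off the roots of the leading coefficient, `Q(z₁, ·)` is a nonzero polynomial in `w`, so it
has finitely many roots. [folklore] -/
theorem finite_roots_fibre {Q : Polynomial (Polynomial ℂ)} (hQ : Q ≠ 0) {z₁ : ℂ}
    (h : ¬ Q.leadingCoeff.IsRoot z₁) :
    {w : ℂ | Q.eval₂ (Polynomial.evalRingHom z₁) w = 0}.Finite := by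
  have hne : Q.map (Polynomial.evalRingHom z₁) ≠ 0 := by
    intro h0
    apply h
    have h1 := congr_arg (fun p => p.coeff Q.natDegree) h0
    simp only [Polynomial.coeff_map, Polynomial.coeff_zero] at h1
    exact h1
  have := Polynomial.finite_setOf_isRoot hne
  refine this.subset fun w hw => ?_
  simp only [Set.mem_setOf_eq, Polynomial.IsRoot.def, Polynomial.eval_map]
  have _ := hQ
  exact hw

/-! ### The point at infinity: `w = 1/v` -/

section Infinity

variable {P Q : Polynomial (Polynomial ℂ)}

/-- **The equation transformed by `w = 1/v`** (Hille (12.1.14)): with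
`m = max(deg_w P, deg_w Q)`, `P̂ = -v² · v^m P(z, 1/v)`, `Q̂ = v^m Q(z, 1/v)` (reflected
polynomials) and the common power `v^e` cancelled, `P̂ = v^e N₁`, `Q̂ = v^e D₁`: whenever
`Q(z, w) d = P(z, w)` with `w ≠ 0`, one has `D₁(z, 1/w) · (-d / w²) = N₁(z, 1/w)` (so
`v = 1/w` solves `D₁(z, v) v' = N₁(z, v)`), and off the roots of a nonzero `c ∈ ℂ[z]` the pair
`(N₁(z, 0), D₁(z, 0))` is not `(0, 0)`. [cite: Hille1969, §12.1 (12.1.14)] -/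
theorem exists_infinity_data (hQ : Q ≠ 0) (hPQ : IsRelPrime P Q) :
    ∃ (c : Polynomial ℂ) (N₁ D₁ : Polynomial (Polynomial ℂ)), c ≠ 0 ∧
      (∀ z w d : ℂ, w ≠ 0 →
        Q.eval₂ (Polynomial.evalRingHom z) w * d = P.eval₂ (Polynomial.evalRingHom z) w →
        D₁.eval₂ (Polynomial.evalRingHom z) w⁻¹ * (-d / w ^ 2) =
          N₁.eval₂ (Polynomial.evalRingHom z) w⁻¹) ∧
      (∀ z : ℂ, ¬ c.IsRoot z →
        N₁.eval₂ (Polynomial.evalRingHom z) 0 ≠ 0 ∨ D₁.eval₂ (Polynomial.evalRingHom z) 0 ≠ 0) := by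
  set m := max P.natDegree Q.natDegree with hm
  set Nh : Polynomial (Polynomial ℂ) := -(X ^ 2 * reflect m P) with hNh
  set Dh : Polynomial (Polynomial ℂ) := reflect m Q with hDh
  set e := min Nh.natTrailingDegree Dh.natTrailingDegree with he
  have hXe_dvd : ∀ R : Polynomial (Polynomial ℂ), e ≤ R.natTrailingDegree → X ^ e ∣ R :=
    fun R hR => Polynomial.X_pow_dvd_iff.mpr fun d hd =>
      Polynomial.coeff_eq_zero_of_lt_natTrailingDegree (lt_of_lt_of_le hd hR)
  obtain ⟨N₁, hN₁⟩ := hXe_dvd Nh (min_le_left _ _)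
  obtain ⟨D₁, hD₁⟩ := hXe_dvd Dh (min_le_right _ _)
  have hDh0 : Dh ≠ 0 := by
    rw [hDh, Ne, Polynomial.reflect_eq_zero_iff]
    exact hQ
  have hcoeffD : D₁.coeff 0 = Dh.coeff e := by
    rw [hD₁, Polynomial.coeff_X_pow_mul', if_pos le_rfl, Nat.sub_self]
  have hcoeffN : N₁.coeff 0 = Nh.coeff e := by
    rw [hN₁, Polynomial.coeff_X_pow_mul', if_pos le_rfl, Nat.sub_self]
  -- the nonzero `z`-polynomial
  set c : Polynomial ℂ :=
    if Dh.natTrailingDegree ≤ Nh.natTrailingDegree then D₁.coeff 0 else N₁.coeff 0 with hc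
  have hc0 : c ≠ 0 := by
    rw [hc]
    split_ifs with hle
    · have he' : e = Dh.natTrailingDegree := by rw [he, min_eq_right hle]
      rw [hcoeffD, he']
      exact Polynomial.trailingCoeff_nonzero_iff_nonzero.mpr hDh0
    · push Not at hle
      have he' : e = Nh.natTrailingDegree := by rw [he, min_eq_left hle.le]
      rw [hcoeffN, he']
      apply Polynomial.trailingCoeff_nonzero_iff_nonzero.mpr
      -- `Nh ≠ 0`, i.e. `P ≠ 0`: otherwise `Q` is a unit and both trailing degrees vanish
      intro hNh0
      have hP0 : P = 0 := by
        have : reflect m P = 0 := by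
          have h2 : (X : Polynomial (Polynomial ℂ)) ^ 2 * reflect m P = 0 := neg_eq_zero.mp hNh0
          exact (mul_eq_zero.mp h2).resolve_left (pow_ne_zero 2 Polynomial.X_ne_zero)
        exact Polynomial.reflect_eq_zero_iff.mp this
      subst hP0
      have hQu : IsUnit Q := isRelPrime_zero_left.mp hPQ
      obtain ⟨u, hu, huQ⟩ := Polynomial.isUnit_iff.mp hQu
      have hm0 : m = 0 := by
        rw [hm, ← huQ]
        simp
      have hDh00 : Dh.natTrailingDegree = 0 := by
        rw [Polynomial.natTrailingDegree_eq_zero]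
        right
        rw [hDh, Polynomial.coeff_reflect, hm0, ← huQ]
        simp [hu.ne_zero]
      rw [hDh00] at hle
      exact Nat.not_lt_zero _ hle
  refine ⟨c, N₁, D₁, hc0, ?_, ?_⟩
  · -- the transformed equation
    intro z w d hw hode
    set i := Polynomial.evalRingHom z with hi
    haveI : Invertible w := invertibleOfNonzero hw
    have hv : (⅟ w : ℂ) = w⁻¹ := invOf_eq_inv w
    have hRQ : eval₂ i w⁻¹ (reflect m Q) * w ^ m = eval₂ i w Q := by
      rw [← hv]
      exact Polynomial.eval₂_reflect_mul_pow i w m Q (le_max_right _ _)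
    have hRP : eval₂ i w⁻¹ (reflect m P) * w ^ m = eval₂ i w P := by
      rw [← hv]
      exact Polynomial.eval₂_reflect_mul_pow i w m P (le_max_left _ _)
    have hwm : w ^ m ≠ 0 := pow_ne_zero m hw
    have hw2 : w ^ 2 ≠ 0 := pow_ne_zero 2 hw
    have key : eval₂ i w⁻¹ Dh * (-d / w ^ 2) = eval₂ i w⁻¹ Nh := by
      apply mul_right_cancel₀ hwm
      have hNh' : eval₂ i w⁻¹ Nh = -(w⁻¹ ^ 2 * eval₂ i w⁻¹ (reflect m P)) := by
        rw [hNh, Polynomial.eval₂_neg, Polynomial.eval₂_mul, Polynomial.eval₂_X_pow]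
      rw [hDh, hNh', mul_right_comm, hRQ, neg_mul, mul_assoc, hRP, ← hode]
      field_simp
    apply mul_left_cancel₀ (pow_ne_zero e (inv_ne_zero hw))
    calc w⁻¹ ^ e * (eval₂ i w⁻¹ D₁ * (-d / w ^ 2))
        = (w⁻¹ ^ e * eval₂ i w⁻¹ D₁) * (-d / w ^ 2) := by ring
      _ = eval₂ i w⁻¹ Dh * (-d / w ^ 2) := by
          rw [hD₁, Polynomial.eval₂_mul, Polynomial.eval₂_X_pow]
      _ = eval₂ i w⁻¹ Nh := key
      _ = w⁻¹ ^ e * eval₂ i w⁻¹ N₁ := by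
          rw [hN₁, Polynomial.eval₂_mul, Polynomial.eval₂_X_pow]
  · -- the values at `v = 0`
    intro z hz
    rw [Polynomial.eval₂_at_zero, Polynomial.eval₂_at_zero]
    simp only [Polynomial.coe_evalRingHom]
    rw [hc] at hz
    split_ifs at hz with hle
    · exact Or.inr hz
    · exact Or.inl hz

end Infinity

/-! ### The package used by the analytic part -/

/-- **The fixed singular points are finite in number** (Hille, proof of Thm. 12.1.1): for
coprime `P, Q ∈ ℂ[z, w]`, `Q ≠ 0`, there are a finite set `S ⊆ ℂ` and polynomials `N₁, D₁`
(the transformed equation at `w = ∞` with common powers of `v` cancelled) such that for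
`ζ ∉ S`: `Q(ζ, ·)` has finitely many zeros; `P(ζ, ·)` and `Q(ζ, ·)` have no common zero;
`(N₁(ζ, 0), D₁(ζ, 0)) ≠ (0, 0)`; and `v = 1/w` transforms `Q w' = P` into `D₁ v' = N₁`.
[cite: Hille1969, §12.1 Thm. 12.1.1 (proof, the set `S`)] -/
theorem fixedSingular_package (P Q : MvPolynomial (Fin 2) ℂ) (hQ : Q ≠ 0)
    (hPQ : IsRelPrime P Q) :
    ∃ (S : Finset ℂ) (N₁ D₁ : MvPolynomial (Fin 2) ℂ),
      (∀ ζ, ζ ∉ S → {A | MvPolynomial.eval ![ζ, A] Q = 0}.Finite) ∧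
      (∀ ζ, ζ ∉ S → ∀ A, MvPolynomial.eval ![ζ, A] P = 0 → MvPolynomial.eval ![ζ, A] Q ≠ 0) ∧
      (∀ z w d : ℂ, w ≠ 0 → MvPolynomial.eval ![z, w] Q * d = MvPolynomial.eval ![z, w] P →
        MvPolynomial.eval ![z, w⁻¹] D₁ * (-d / w ^ 2) = MvPolynomial.eval ![z, w⁻¹] N₁) ∧
      (∀ ζ, ζ ∉ S → MvPolynomial.eval ![ζ, 0] N₁ ≠ 0 ∨ MvPolynomial.eval ![ζ, 0] D₁ ≠ 0) := by
  classical
  obtain ⟨e, he⟩ := exists_bivariate_algEquiv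
  set P' := e P with hP'
  set Q' := e Q with hQ'
  have hQ'0 : Q' ≠ 0 := by
    rw [hQ']
    exact (map_ne_zero_iff e e.injective).mpr hQ
  have hPQ' : IsRelPrime P' Q' := by
    intro d hdP hdQ
    have h1 : e.symm d ∣ P := by simpa [hP'] using map_dvd e.symm hdP
    have h2 : e.symm d ∣ Q := by simpa [hQ'] using map_dvd e.symm hdQ
    simpa using (hPQ h1 h2).map e
  obtain ⟨c₂, A, B, hc₂, hAB⟩ := exists_bezout_of_isRelPrime hPQ'
  obtain ⟨c₃, N₁, D₁, hc₃, hid, hinf⟩ := exists_infinity_data hQ'0 hPQ'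
  have hlc : Q'.leadingCoeff ≠ 0 := Polynomial.leadingCoeff_ne_zero.mpr hQ'0
  refine ⟨Q'.leadingCoeff.roots.toFinset ∪ c₂.roots.toFinset ∪ c₃.roots.toFinset,
    e.symm N₁, e.symm D₁, ?_, ?_, ?_, ?_⟩
  · intro ζ hζ
    have h1 : ¬ Q'.leadingCoeff.IsRoot ζ := by
      intro h
      apply hζ
      simp only [Finset.mem_union, Multiset.mem_toFinset, Polynomial.mem_roots hlc]
      exact Or.inl (Or.inl h)
    have := finite_roots_fibre hQ'0 h1
    simpa only [hQ', he] using this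
  · intro ζ hζ A hP0 hQ0
    apply hζ
    have hroot : c₂.IsRoot ζ :=
      isRoot_of_common_zero hAB (z₁ := ζ) (w₁ := A) (by rw [hP', he]; exact hP0)
        (by rw [hQ', he]; exact hQ0)
    simp only [Finset.mem_union, Multiset.mem_toFinset, Polynomial.mem_roots hc₂]
    exact Or.inl (Or.inr hroot)
  · intro z w d hw hode
    have h := hid z w d hw (by rw [hQ', hP', he, he]; exact hode)
    rwa [← e.apply_symm_apply N₁, ← e.apply_symm_apply D₁, he, he] at h
  · intro ζ hζ
    have h3 : ¬ c₃.IsRoot ζ := by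
      intro h
      apply hζ
      simp only [Finset.mem_union, Multiset.mem_toFinset, Polynomial.mem_roots hc₃]
      exact Or.inr h
    have h := hinf ζ h3
    rwa [← e.apply_symm_apply N₁, ← e.apply_symm_apply D₁, he, he] at h

end Literature.Analysis.ODE
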